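import Literature.NumberTheory.EllipticCurves.NewformsSpanGamma1Proofs
import Literature.NumberTheory.EllipticCurves.CuspFormLFunctionProofs
import Literature.FieldTheory.AlgClosed.PadicAlgClEquivComplex
import HarnessLib

/-!
# A cusp form congruent to a formal Hecke eigenvector is a Hecke eigenvector modulo `𝔪`

Topic `Literature/NumberTheory/EllipticCurves`; namespace
`Literature.NumberTheory.EllipticCurves.ModularForms`. THEOREMS ONLY.

Let `G ∈ S_k(L, χ)` (`nebentypusSubspace`), `q ∤ L` a prime, and let `b : ℕ → ℂ` satisfy the
formal Hecke relation `b_{qn} + χ(q) q^{k-1} [q ∣ n] b_{n/q} = λ b_n` (`n ≥ 1`) — e.g. the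
`q`-expansion of an Eisenstein series `E_k^{𝟙,χ}` or of its level-raising `E - E(M·)`
(`TwistedDivisorSumsHecke`), `λ = 1 + χ(q) q^{k-1}`.  If `a_n(G) ≡ b_n (mod 𝔪)` for all
`n ≥ 1` (congruences read in `ℚ̄_p` through `ι⁻¹`, `ι : ℚ̄_p ≃ ℂ`; `χ(q) q^{k-1}` and `λ`
`p`-integral), then by Diamond–Shurman (5.3), `a_n(T_q G) = a_{qn}(G) + χ(q) q^{k-1} a_{n/q}(G)`,

  `a_n(T_q G) ≡ λ a_n(G) (mod 𝔪)` for all `n`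

(`valuation_cuspCoeff_heckeT_sub_lt_one`): `G` is an eigenvector of `T_q` modulo `𝔪` with
eigenvalue `λ` — the input of the Deligne–Serre lifting lemma (op. cit. 6.11) in Billerey–Menares'
proof of Thm. 2 (§3.2: "`f` [the reduction of `F₂`] is a cuspidal eigenform for the full Hecke
algebra … by the Deligne–Serre lifting lemma there exists a normalised eigenform with the same
eigenvalues mod `p`").

## References

* N. Billerey, R. Menares, *Strong modularity of reducible Galois representations*, Trans. AMS
  370 (2018), §3.2. [BillereyMenares2018]
* F. Diamond, J. Shurman, *A First Course in Modular Forms*, GTM 228 (2005), Prop. 5.2.2,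
  (5.3). [DiamondShurman2005]
-/

noncomputable section

open CongruenceSubgroup
open scoped MatrixGroups ModularForm

namespace Literature.NumberTheory.EllipticCurves.ModularForms

variable {L : ℕ} [NeZero L] {k : ℤ} {p : ℕ} [Fact p.Prime]

/-- `⟨q⟩ G = χ(q) G` for `G ∈ S_k(L, χ)` and `q` prime to `L`, on Fourier coefficients. [folklore] -/
theorem cuspCoeff_diamondOp_of_mem_nebentypusSubspace {χ : DirichletCharacter ℂ L}
    {G : CuspForm (Gamma1 L) k} (hG : G ∈ nebentypusSubspace L k χ) {q : ℕ}
    (hq : IsUnit (q : ZMod L)) (n : ℕ) :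
    cuspCoeff (diamondOp L k (q : ZMod L) G) n = χ q * cuspCoeff G n := by
  have h : ∀ d : (ZMod L)ˣ, diamondOp L k (d : ZMod L) G = χ (d : ZMod L) • G := by
    simpa only [nebentypusSubspace, Submodule.mem_iInf, LinearMap.mem_ker, LinearMap.sub_apply,
      LinearMap.smul_apply, LinearMap.id_apply, sub_eq_zero] using hG
  have h' := h hq.unit
  rw [IsUnit.unit_spec] at h'
  rw [h', cuspCoeff_smul_gamma1]

omit [NeZero L] in
/-- Ultrametric bookkeeping: `v(x + y - z) < 1` from `v(x), v(y), v(z) < 1`. [folklore] -/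
private theorem valuation_add_sub_lt_one {x y z : PadicAlgCl p} (hx : Valued.v x < 1)
    (hy : Valued.v y < 1) (hz : Valued.v z < 1) : Valued.v (x + y - z) < 1 := by
  refine lt_of_le_of_lt (Valuation.map_sub _ _ _) (max_lt ?_ hz)
  exact lt_of_le_of_lt (Valuation.map_add _ _ _) (max_lt hx hy)

/-- **A cusp form congruent modulo `𝔪` to a formal `T_q`-eigenvector is a `T_q`-eigenvector
modulo `𝔪`.**  For `G ∈ S_k(L, χ)`, a prime `q ∤ L`, `b : ℕ → ℂ` with
`b_{qn} + χ(q) q^{k-1} [q ∣ n] b_{n/q} = λ b_n` (`n ≥ 1`), `χ(q) q^{k-1}` and `λ` `p`-integral and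
`a_n(G) ≡ b_n (mod 𝔪)` for `n ≥ 1`: `a_n(T_q G) ≡ λ a_n(G) (mod 𝔪)` for every `n`.
[cite: BillereyMenares2018, §3.2; DiamondShurman2005, Prop. 5.2.2 (5.3)] -/
theorem valuation_cuspCoeff_heckeT_sub_lt_one (ι : PadicAlgCl p ≃+* ℂ)
    {χ : DirichletCharacter ℂ L} {G : CuspForm (Gamma1 L) k} (hG : G ∈ nebentypusSubspace L k χ)
    {q : ℕ} [NeZero q] (hq : q.Prime) (hqL : ¬ q ∣ L) (b : ℕ → ℂ) (lam : ℂ)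
    (hb : ∀ n, n ≠ 0 →
      b (q * n) + χ q * (q : ℂ) ^ (k - 1) * (if q ∣ n then b (n / q) else 0) = lam * b n)
    (hint : Valued.v (ι.symm (χ q * (q : ℂ) ^ (k - 1))) ≤ 1) (hlam : Valued.v (ι.symm lam) ≤ 1)
    (hcong : ∀ n, n ≠ 0 → Valued.v (ι.symm (cuspCoeff G n - b n)) < 1) (n : ℕ) :
    Valued.v (ι.symm (cuspCoeff (heckeT (Gamma1 L) k q G) n - lam * cuspCoeff G n)) < 1 := by
  have h1 := HeckeTGamma1.one_mem_strictPeriods_Gamma1 L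
  rcases Nat.eq_zero_or_pos n with rfl | hn
  · rw [cuspCoeff_zero h1, cuspCoeff_zero h1, mul_zero, sub_zero, map_zero, Valuation.map_zero]
    exact zero_lt_one
  have hn0 : n ≠ 0 := hn.ne'
  have hunit : IsUnit (q : ZMod L) := (ZMod.isUnit_prime_iff_not_dvd hq).2 hqL
  rw [cuspCoeff_heckeT_gamma1 G q hq n, if_neg hqL]
  -- rewrite `a_{n/q}(⟨q⟩ G) = χ(q) a_{n/q}(G)`
  have hdia : (if q ∣ n then cuspCoeff (diamondOp L k q G) (n / q) else 0) =
      χ q * (if q ∣ n then cuspCoeff G (n / q) else 0) := by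
    split_ifs
    · exact cuspCoeff_diamondOp_of_mem_nebentypusSubspace hG hunit _
    · rw [mul_zero]
  rw [hdia]
  have hqn0 : q * n ≠ 0 := mul_ne_zero hq.ne_zero hn0
  -- the three error terms
  have e1 := hcong (q * n) hqn0
  have e2 : Valued.v (ι.symm (χ q * (q : ℂ) ^ (k - 1) *
      ((if q ∣ n then cuspCoeff G (n / q) else 0) - (if q ∣ n then b (n / q) else 0)))) < 1 := by
    rw [map_mul, Valuation.map_mul]
    refine lt_of_le_of_lt (mul_le_mul' hint le_rfl) ?_
    rw [one_mul]
    split_ifs with hqn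
    · have : n / q ≠ 0 := by
        obtain ⟨m, rfl⟩ := hqn
        rw [Nat.mul_div_cancel_left m hq.pos]
        rintro rfl; exact hn0 (mul_zero q)
      exact hcong _ this
    · rw [sub_zero, map_zero, Valuation.map_zero]; exact zero_lt_one
  have e3 : Valued.v (ι.symm (lam * (cuspCoeff G n - b n))) < 1 := by
    rw [map_mul, Valuation.map_mul]
    refine lt_of_le_of_lt (mul_le_mul' hlam le_rfl) ?_
    rw [one_mul]; exact hcong n hn0
  have key : cuspCoeff G (q * n) + (q : ℂ) ^ (k - 1) * (χ q * (if q ∣ n then cuspCoeff G (n / q) else 0)) -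
      lam * cuspCoeff G n =
      (cuspCoeff G (q * n) - b (q * n)) +
        χ q * (q : ℂ) ^ (k - 1) *
          ((if q ∣ n then cuspCoeff G (n / q) else 0) - (if q ∣ n then b (n / q) else 0)) -
        lam * (cuspCoeff G n - b n) := by
    linear_combination hb n hn0
  rw [key, map_sub, map_add]
  exact valuation_add_sub_lt_one e1 e2 e3

end Literature.NumberTheory.EllipticCurves.ModularForms
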